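import Summits.Parity.BatemanHorn.Theorems.SoloInformedHarmonicDecayConvolution
import Summits.Parity.BatemanHorn.Theorems.SoloInformedCompletelyMultiplicativeFactor
import Summits.Parity.BatemanHorn.Theorems.SoloInformedEulerProductSummability
import Summits.Parity.BatemanHorn.Theorems.SoloInformedSquarefreeSysRootCountSum
import Summits.Parity.BatemanHorn.Theorems.SoloInformedLogMomentConvergence
import Literature.NumberTheory.LFunctions.PolynomialRootMoebiusSharpCutoffExp
import Literature.NumberTheory.LFunctions.BatemanHornSystemEulerProduct
import Literature.NumberTheory.Sieve.BatemanHornProofs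
import Literature.NumberTheory.Sieve.ParityBatemanHorn

/-!
# SoloInformedSystemMoebiusDecay — `∑_{n ≤ N} μ(n) ω_f(n)/n ≪_B (log N)^{-B}` for every Bateman–Horn system

Solo unit `solo-Parity-informed` (ideation tier, informed mode), session 17; `PLAN.md` §25.3 (α1), CLAIMS C86.

For every Bateman–Horn system `f` (`k = card ι ≥ 1`, `ω_f = ρ_F`, `F = ∏ fᵢ`) and every `B`,
`|∑_{n ≤ N} μ(n) ω_f(n)/n| ≤ C_B / (1 + log N)^B` (`sys_moebiusRootCount_div_logPowDecay`), and
`∑_{n ≤ N} |μ(n)| ω_f(n)/n ≤ K (1 + log N)^k` (`sum_abs_moebius_sysRootCount_div_le`).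

Proof: induction on the number of polynomials.  One polynomial: the prime ideal theorem with
de la Vallée-Poussin remainder (`Literature…abs_sum_moebius_rootCount_div_le_log_pow`).  Step
`F = G·g`: `μρ_F/n = μρ_G/n ⋆ μρ_g/n ⋆ γ` with `∑ |γ(n)| n^δ < ∞`
(`SoloInformedCompletelyMultiplicativeFactor`, `SoloInformedEulerProductSummability`; the input is
`ρ_F(p) = ρ_G(p) + ρ_g(p)` for all large `p`, Bateman–Horn 1962 p. 364), and log-power decay is
stable under both convolutions (`SoloInformedHarmonicDecayConvolution`).  This is the unconditional
input `(H_k)` of the `k`-dimensional localisation of the Bateman–Horn conjecture (`PLAN.md` §25).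
-/

namespace Summit.Parity.BatemanHorn.Theorems

open Finset Real ArithmeticFunction Polynomial
open scoped ArithmeticFunction.Moebius
open Literature.NumberTheory.Sieve (polyRootCountMod IsBatemanHornSystem polyRootCountMod_comp_equiv)
open Literature.NumberTheory.LFunctions (polyRootCountModSys_mul_of_coprime sys_rootCount_le
  sys_rootCount_le_sub_one abs_sum_moebius_rootCount_div_le_log_pow polyRootCountMod_prod_single)

variable {ι : Type*} [Fintype ι]

/-! ### Sub-systems and reindexing -/

/-- The root count of a sub-system is at most that of the system. -/
theorem polyRootCountMod_comp_le (f : ι → ℤ[X]) {κ : Type*} [Fintype κ] {e : κ → ι}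
    (he : Function.Injective e) (p : ℕ) :
    polyRootCountMod (f ∘ e) p ≤ polyRootCountMod f p := by
  classical
  unfold polyRootCountMod
  refine card_le_card fun n hn => ?_
  rw [mem_filter] at hn ⊢
  refine ⟨hn.1, hn.2.trans ?_⟩
  have : ∏ j, ((f ∘ e) j).eval (n : ℤ) = ∏ i ∈ univ.map ⟨e, he⟩, (f i).eval (n : ℤ) := by
    rw [prod_map]; rfl
  rw [this]
  exact prod_dvd_prod_of_subset _ _ _ (subset_univ _)

/-- A sub-system of a Bateman–Horn system is a Bateman–Horn system. -/
theorem isBatemanHornSystem_comp {f : ι → ℤ[X]} (hf : IsBatemanHornSystem f) {κ : Type*}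
    [Fintype κ] {e : κ → ι} (he : Function.Injective e) : IsBatemanHornSystem (f ∘ e) where
  irreducible j := hf.irreducible (e j)
  leadingCoeff_pos j := hf.leadingCoeff_pos (e j)
  pairwise_not_associated := fun _ _ hij => hf.pairwise_not_associated (he.ne hij)
  hasNoFixedPrimeDivisor p hp :=
    (polyRootCountMod_comp_le f he p).trans_lt (hf.hasNoFixedPrimeDivisor p hp)

/-! ### The harmonic bound `∑_{n ≤ N} |μ(n)| ω_f(n)/n ≤ K (1 + log N)^k` -/

/-- `∑_{n ≤ N} |μ(n)| ω_f(n)/n ≤ K (1 + log N)^k` for a Bateman–Horn system of `k ≥ 1`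
polynomials (partial summation of `∑_{n ≤ y} |μ(n)| ω_f(n) ≤ C y log^{k-1} y`). -/
theorem sum_abs_moebius_sysRootCount_div_le {f : ι → ℤ[X]} (hf : IsBatemanHornSystem f)
    (hk : 0 < Fintype.card ι) :
    ∃ (K : ℝ) (κ : ℕ), ∀ N : ℕ, 1 ≤ N →
      ∑ n ∈ Icc 1 N, |(μ n : ℝ) * (polyRootCountMod f n : ℝ) / n| ≤ K * (1 + Real.log N) ^ κ := by
  obtain ⟨C, hC0, hC⟩ := exists_sum_abs_moebius_mul_sysRootCount_le' hf hk
  set k := Fintype.card ι with hkdef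
  set C' : ℝ := max C 1 with hC'
  have hC'1 : 1 ≤ C' := le_max_right _ _
  have hCC' : C ≤ C' := le_max_left _ _
  -- `A(n) ≤ C' n (1 + log n)^{k-1}` for all `n ≥ 1`
  have hA : ∀ n : ℕ, 1 ≤ n →
      ∑ m ∈ Icc 1 n, |(μ m : ℝ)| * (polyRootCountMod f m : ℝ) ≤ C' * n * (1 + Real.log n) ^ (k - 1) := by
    intro n hn
    rcases eq_or_lt_of_le hn with h1 | h2
    · rw [← h1]
      simp only [Icc_self, sum_singleton, ArithmeticFunction.moebius_apply_one, Int.cast_one,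
        abs_one, polyRootCountMod_sys_one, Nat.cast_one, Real.log_one, add_zero, one_pow,
        mul_one]
      exact hC'1
    · have hn2 : (2 : ℝ) ≤ n := by exact_mod_cast h2
      have h := hC n hn2
      rw [Nat.floor_natCast] at h
      have hl0 : 0 ≤ Real.log n := Real.log_nonneg (by linarith)
      calc ∑ m ∈ Icc 1 n, |(μ m : ℝ)| * (polyRootCountMod f m : ℝ)
          ≤ C * n * Real.log n ^ (k - 1) := h
        _ ≤ C' * n * (1 + Real.log n) ^ (k - 1) := by
            have h3 : Real.log n ^ (k - 1) ≤ (1 + Real.log n) ^ (k - 1) :=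
              pow_le_pow_left₀ hl0 (by linarith) _
            have hn0 : (0 : ℝ) ≤ n := Nat.cast_nonneg n
            calc C * n * Real.log n ^ (k - 1) ≤ C * n * (1 + Real.log n) ^ (k - 1) :=
                  mul_le_mul_of_nonneg_left h3 (mul_nonneg hC0.le hn0)
              _ ≤ C' * n * (1 + Real.log n) ^ (k - 1) := by gcongr
  refine ⟨2 * C', k, fun N hN => ?_⟩
  have hl0 : 0 ≤ Real.log N := Real.log_nonneg (by exact_mod_cast hN)
  set L : ℝ := 1 + Real.log N with hL
  have hL1 : 1 ≤ L := by rw [hL]; linarith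
  -- rewrite the terms as `(|μ| ρ) · (1/n)` and sum by parts
  have hterm : ∀ n ∈ Icc 1 N, |(μ n : ℝ) * (polyRootCountMod f n : ℝ) / n| =
      (|(μ n : ℝ)| * (polyRootCountMod f n : ℝ)) * (1 / (n : ℝ)) := by
    intro n _
    rw [abs_div, abs_mul, Nat.abs_cast, Nat.abs_cast]
    ring
  rw [sum_congr rfl hterm, sum_mul_kernel_eq _ _ hN]
  -- boundary term
  have hNpos : (0 : ℝ) < N := by exact_mod_cast hN
  have hbd : (∑ n ∈ Icc 1 N, |(μ n : ℝ)| * (polyRootCountMod f n : ℝ)) * (1 / (N : ℝ)) ≤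
      C' * L ^ (k - 1) := by
    rw [mul_one_div, div_le_iff₀ hNpos]
    calc ∑ n ∈ Icc 1 N, |(μ n : ℝ)| * (polyRootCountMod f n : ℝ) ≤ C' * N * L ^ (k - 1) := hA N hN
      _ = C' * L ^ (k - 1) * N := by ring
  -- summed terms
  have hsum : ∑ n ∈ Ico 1 N, (∑ m ∈ Icc 1 n, |(μ m : ℝ)| * (polyRootCountMod f m : ℝ)) *
      (1 / (n : ℝ) - 1 / ((n + 1 : ℕ) : ℝ)) ≤ C' * L ^ (k - 1) * L := by
    have hstep : ∀ n ∈ Ico 1 N, (∑ m ∈ Icc 1 n, |(μ m : ℝ)| * (polyRootCountMod f m : ℝ)) *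
        (1 / (n : ℝ) - 1 / ((n + 1 : ℕ) : ℝ)) ≤ C' * L ^ (k - 1) * (1 / ((n : ℝ) + 1)) := by
      intro n hn
      rw [mem_Ico] at hn
      have hn1 : (1 : ℝ) ≤ n := by exact_mod_cast hn.1
      have hn0 : (0 : ℝ) < n := by linarith
      have hdiff : 1 / (n : ℝ) - 1 / ((n + 1 : ℕ) : ℝ) = 1 / ((n : ℝ) * ((n : ℝ) + 1)) := by
        push_cast
        field_simp
        ring
      rw [hdiff]
      have hlogn : 1 + Real.log n ≤ L := by
        rw [hL]
        have : Real.log n ≤ Real.log N :=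
          Real.log_le_log hn0 (by exact_mod_cast hn.2.le)
        linarith
      have hln0 : 0 ≤ 1 + Real.log n := by linarith [Real.log_nonneg hn1]
      calc (∑ m ∈ Icc 1 n, |(μ m : ℝ)| * (polyRootCountMod f m : ℝ)) * (1 / ((n : ℝ) * ((n : ℝ) + 1)))
          ≤ C' * n * (1 + Real.log n) ^ (k - 1) * (1 / ((n : ℝ) * ((n : ℝ) + 1))) :=
            mul_le_mul_of_nonneg_right (hA n hn.1) (by positivity)
        _ = C' * (1 + Real.log n) ^ (k - 1) * (1 / ((n : ℝ) + 1)) := by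
            field_simp
        _ ≤ C' * L ^ (k - 1) * (1 / ((n : ℝ) + 1)) := by
            have : (1 + Real.log n) ^ (k - 1) ≤ L ^ (k - 1) := pow_le_pow_left₀ hln0 hlogn _
            have hC'0 : 0 ≤ C' := by linarith
            gcongr
    refine (sum_le_sum hstep).trans ?_
    rw [← mul_sum]
    refine mul_le_mul_of_nonneg_left ?_ (by positivity)
    -- `∑_{1 ≤ n < N} 1/(n+1) ≤ harmonic N ≤ 1 + log N`
    have hharm : ∑ n ∈ Ico 1 N, 1 / ((n : ℝ) + 1) ≤ (harmonic N : ℝ) := by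
      have hcast : (harmonic N : ℝ) = ∑ i ∈ range N, 1 / ((i : ℝ) + 1) := by
        simp only [harmonic, one_div, Rat.cast_sum, Rat.cast_inv, Rat.cast_add, Rat.cast_one,
          Rat.cast_natCast, Nat.cast_add, Nat.cast_one]
      rw [hcast]
      refine sum_le_sum_of_subset_of_nonneg (fun n hn => ?_) fun n _ _ => by positivity
      rw [mem_Ico] at hn
      exact mem_range.mpr hn.2
    exact hharm.trans (by rw [hL]; exact harmonic_le_one_add_log N)
  calc (∑ n ∈ Icc 1 N, |(μ n : ℝ)| * (polyRootCountMod f n : ℝ)) * (1 / (N : ℝ)) +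
        ∑ n ∈ Ico 1 N, (∑ m ∈ Icc 1 n, |(μ m : ℝ)| * (polyRootCountMod f m : ℝ)) *
          (1 / (n : ℝ) - 1 / ((n + 1 : ℕ) : ℝ))
      ≤ C' * L ^ (k - 1) + C' * L ^ (k - 1) * L := add_le_add hbd hsum
    _ ≤ C' * L ^ k + C' * L ^ k := by
        have hC'0 : 0 ≤ C' := by linarith
        have h1 : L ^ (k - 1) ≤ L ^ k := pow_le_pow_right₀ hL1 (Nat.sub_le k 1)
        have h2 : L ^ (k - 1) * L = L ^ k := by
          rw [← pow_succ]
          congr 1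
          omega
        rw [mul_assoc, h2]
        gcongr
    _ = 2 * C' * L ^ k := by ring

/-! ### The single-polynomial decay in normal form -/

/-- `|∑_{n ≤ N} μ(n) ρ_g(n)/n| ≤ C_B/(1 + log N)^B` for irreducible non-constant `g`
(normal form of `Literature…abs_sum_moebius_rootCount_div_le_log_pow`). -/
theorem single_moebiusRootCount_div_logPowDecay {g : ℤ[X]} (hirr : Irreducible g)
    (hdeg : 0 < g.natDegree) (B : ℕ) :
    ∃ C : ℝ, ∀ N : ℕ, 1 ≤ N →
      |∑ n ∈ Icc 1 N, (μ n : ℝ) * (polyRootCountMod ![g] n : ℝ) / n| ≤ C / (1 + Real.log N) ^ B := by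
  obtain ⟨C, hC⟩ := abs_sum_moebius_rootCount_div_le_log_pow hirr hdeg B
  refine ⟨1 + max C 0 * 3 ^ B, fun N hN => ?_⟩
  have hl0 : 0 ≤ Real.log N := Real.log_nonneg (by exact_mod_cast hN)
  have hL0 : 0 < 1 + Real.log N := by linarith
  rcases eq_or_lt_of_le hN with h1 | h2
  · rw [← h1]
    simp only [Icc_self, sum_singleton, ArithmeticFunction.moebius_apply_one, Int.cast_one, one_mul,
      polyRootCountMod_sys_one, Nat.cast_one, div_one, abs_one, Real.log_one, add_zero, one_pow]
    have : 0 ≤ max C 0 * 3 ^ B := by positivity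
    linarith
  · have hN2 : (2 : ℝ) ≤ N := by exact_mod_cast h2
    have h := hC N hN2
    rw [Nat.floor_natCast] at h
    have hlog2 : (1 : ℝ) / 2 < Real.log N := by
      have := Real.log_two_gt_d9
      have h2' : Real.log 2 ≤ Real.log N := Real.log_le_log (by norm_num) hN2
      linarith
    have hlpos : 0 < Real.log N := by linarith
    have h3 : 1 + Real.log N ≤ 3 * Real.log N := by linarith
    have h4 : (1 + Real.log N) ^ B ≤ 3 ^ B * Real.log N ^ B := by
      rw [← mul_pow]; exact pow_le_pow_left₀ hL0.le h3 B
    calc |∑ n ∈ Icc 1 N, (μ n : ℝ) * (polyRootCountMod ![g] n : ℝ) / n| ≤ C / Real.log N ^ B := h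
      _ ≤ max C 0 / Real.log N ^ B := div_le_div_of_nonneg_right (le_max_left _ _) (by positivity)
      _ = max C 0 * 3 ^ B / (3 ^ B * Real.log N ^ B) := by
          rw [mul_comm ((3 : ℝ) ^ B) (Real.log N ^ B), mul_div_mul_right _ _ (by positivity)]
      _ ≤ max C 0 * 3 ^ B / (1 + Real.log N) ^ B :=
          div_le_div_of_nonneg_left (by positivity) (by positivity) h4
      _ ≤ (1 + max C 0 * 3 ^ B) / (1 + Real.log N) ^ B :=
          div_le_div_of_nonneg_right (by linarith) (by positivity)

/-! ### The arithmetic function `μ ω_f / n` -/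

/-- The multiplicative arithmetic function `n ↦ μ(n) ω_f(n)/n`: values at primes and prime powers. -/
theorem exists_moebiusSysRootCountDiv (f : ι → ℤ[X]) :
    ∃ h : ArithmeticFunction ℝ, (∀ n : ℕ, h n = (μ n : ℝ) * (polyRootCountMod f n : ℝ) / n) ∧
      h.IsMultiplicative ∧ (∀ p : ℕ, p.Prime → h p = -((polyRootCountMod f p : ℝ) / p)) ∧
      ∀ p k : ℕ, p.Prime → 2 ≤ k → h (p ^ k) = 0 := by
  refine ⟨⟨fun n => (μ n : ℝ) * (polyRootCountMod f n : ℝ) / n, by simp⟩, fun n => rfl,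
    ⟨?_, ?_⟩, ?_, ?_⟩
  · simp only [coe_mk, ArithmeticFunction.moebius_apply_one, Int.cast_one, one_mul,
      polyRootCountMod_sys_one, Nat.cast_one, div_one]
  · intro m n hmn
    simp only [coe_mk]
    rw [ArithmeticFunction.isMultiplicative_moebius.map_mul_of_coprime hmn,
      polyRootCountModSys_mul_of_coprime f hmn]
    push_cast
    rw [div_mul_div_comm]
    congr 1
    ring
  · intro p hp
    simp only [coe_mk, ArithmeticFunction.moebius_apply_prime hp]
    push_cast
    ring
  · intro p k hp hk
    simp only [coe_mk]
    rw [ArithmeticFunction.moebius_apply_prime_pow hp (by omega), if_neg (by omega)]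
    simp

/-! ### The induction -/

/-- Log-power decay for systems indexed by `Fin (k+1)`, by induction on `k`. -/
theorem fin_moebiusRootCount_div_logPowDecay : ∀ (k : ℕ) (f : Fin (k + 1) → ℤ[X]),
    IsBatemanHornSystem f → ∀ B : ℕ, ∃ C : ℝ, ∀ N : ℕ, 1 ≤ N →
      |∑ n ∈ Icc 1 N, (μ n : ℝ) * (polyRootCountMod f n : ℝ) / n| ≤ C / (1 + Real.log N) ^ B := by
  intro k
  induction k with
  | zero =>
    intro f hf B
    obtain ⟨C, hC⟩ := single_moebiusRootCount_div_logPowDecay (hf.irreducible 0) (hf.natDegree_pos 0) B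
    refine ⟨C, fun N hN => ?_⟩
    have hρ : ∀ n : ℕ, polyRootCountMod f n = polyRootCountMod ![f 0] n := by
      intro n; rw [← polyRootCountMod_prod_single f n, Fin.prod_univ_one]
    simp_rw [hρ]
    exact hC N hN
  | succ k ih =>
    intro f hf B
    -- the two sub-systems
    have ht : IsBatemanHornSystem (f ∘ Fin.succ) := isBatemanHornSystem_comp hf (Fin.succ_injective _)
    have hcomp0 : (f ∘ fun _ : Fin 1 => (0 : Fin (k + 2))) = ![f 0] := by
      funext i; fin_cases i; rfl
    have hg : IsBatemanHornSystem ![f 0] := by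
      rw [← hcomp0]
      exact isBatemanHornSystem_comp hf (fun a b _ => Subsingleton.elim a b)
    -- the three arithmetic functions
    obtain ⟨h₁, h₁v, h₁m, h₁p, h₁pp⟩ := exists_moebiusSysRootCountDiv (f ∘ Fin.succ)
    obtain ⟨h₂, h₂v, h₂m, h₂p, h₂pp⟩ := exists_moebiusSysRootCountDiv ![f 0]
    obtain ⟨h₃, h₃v, h₃m, h₃p, h₃pp⟩ := exists_moebiusSysRootCountDiv f
    -- root data
    have hle1 : ∀ p : ℕ, (polyRootCountMod (f ∘ Fin.succ) p : ℝ) ≤ polyRootCountMod f p := fun p => by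
      exact_mod_cast polyRootCountMod_comp_le f (Fin.succ_injective _) p
    have hle2 : ∀ p : ℕ, (polyRootCountMod ![f 0] p : ℝ) ≤ polyRootCountMod f p := fun p => by
      rw [← hcomp0]
      exact_mod_cast polyRootCountMod_comp_le f
        (e := fun _ : Fin 1 => (0 : Fin (k + 2))) (fun a b _ => Subsingleton.elim a b) p
    obtain ⟨γ, hγm, hγeq, hγp, hγpk⟩ := exists_conv_factor h₁m h₂m h₃m h₁p h₂p h₃p h₁pp h₂pp h₃pp
      (fun p _ => ⟨Nat.cast_nonneg _, Nat.cast_nonneg _⟩) (fun p _ => ⟨hle1 p, hle2 p⟩)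
    -- additivity of the root counts for large primes
    obtain ⟨P₀, hP₀⟩ := hf.exists_polyRootCountMod_eq_sum
    obtain ⟨P₁, hP₁⟩ := ht.exists_polyRootCountMod_eq_sum
    have hadd : ∀ p : ℕ, p.Prime → max P₀ P₁ < p →
        polyRootCountMod f p = polyRootCountMod (f ∘ Fin.succ) p + polyRootCountMod ![f 0] p := by
      intro p hp hP
      rw [hP₀ p hp (lt_of_le_of_lt (le_max_left _ _) hP),
        hP₁ p hp (lt_of_le_of_lt (le_max_right _ _) hP), Fin.sum_univ_succ, add_comm]
      rfl
    -- summability of `γ n n^δ`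
    set D : ℝ := ((∑ i, (f i).natDegree : ℕ) : ℝ) with hD
    obtain ⟨δ, hδ, hsum⟩ := summable_abs_mul_rpow_of_prime_pow_bound hγm
      (t := fun p => (polyRootCountMod f p : ℝ) / p) (D := D) (Q := max P₀ P₁)
      (fun p _ => by positivity)
      (fun p hp => by
        have hp0 : (0 : ℝ) < p := by exact_mod_cast hp.pos
        have h := sys_rootCount_le_sub_one hf hp
        calc (polyRootCountMod f p : ℝ) / p ≤ ((p : ℝ) - 1) / p := div_le_div_of_nonneg_right h hp0.le
          _ = 1 - 1 / p := by field_simp)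
      (fun p j hp hj => hγpk p j hp hj)
      (fun p hp hP => by
        refine ⟨?_, ?_⟩
        · rw [hγp p hp, hadd p hp hP]
          push_cast
          ring
        · exact div_le_div_of_nonneg_right (sys_rootCount_le hf hp) (Nat.cast_nonneg p))
    -- decay and harmonic bounds of the factors
    have hd1 : ∀ B : ℕ, ∃ C : ℝ, ∀ N : ℕ, 1 ≤ N →
        |∑ n ∈ Icc 1 N, h₁ n| ≤ C / (1 + Real.log N) ^ B := by
      simp_rw [h₁v]; exact ih (f ∘ Fin.succ) ht
    have hd2 : ∀ B : ℕ, ∃ C : ℝ, ∀ N : ℕ, 1 ≤ N →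
        |∑ n ∈ Icc 1 N, h₂ n| ≤ C / (1 + Real.log N) ^ B := by
      simp_rw [h₂v]
      exact single_moebiusRootCount_div_logPowDecay (hf.irreducible 0) (hf.natDegree_pos 0)
    have hH1 : ∃ (K : ℝ) (κ : ℕ), ∀ N : ℕ, 1 ≤ N →
        ∑ n ∈ Icc 1 N, |h₁ n| ≤ K * (1 + Real.log N) ^ κ := by
      simp_rw [h₁v]; exact sum_abs_moebius_sysRootCount_div_le ht (by simp)
    have hH2 : ∃ (K : ℝ) (κ : ℕ), ∀ N : ℕ, 1 ≤ N →
        ∑ n ∈ Icc 1 N, |h₂ n| ≤ K * (1 + Real.log N) ^ κ := by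
      simp_rw [h₂v]; exact sum_abs_moebius_sysRootCount_div_le hg (by simp)
    have hd12 : ∀ B : ℕ, ∃ C : ℝ, ∀ N : ℕ, 1 ≤ N →
        |∑ n ∈ Icc 1 N, (h₁ * h₂) n| ≤ C / (1 + Real.log N) ^ B :=
      fun B => logPowDecay_mul hd1 hd2 hH1 hH2 B
    have hd3 := logPowDecay_mul_of_summable hd12 hδ hsum B
    rw [hγeq] at hd3
    simp_rw [h₃v] at hd3
    exact hd3

/-- **Log-power decay of `∑_{n ≤ N} μ(n) ω_f(n)/n` for every Bateman–Horn system.** -/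
theorem sys_moebiusRootCount_div_logPowDecay {f : ι → ℤ[X]} (hf : IsBatemanHornSystem f)
    (hk : 0 < Fintype.card ι) (B : ℕ) :
    ∃ C : ℝ, ∀ N : ℕ, 1 ≤ N →
      |∑ n ∈ Icc 1 N, (μ n : ℝ) * (polyRootCountMod f n : ℝ) / n| ≤ C / (1 + Real.log N) ^ B := by
  obtain ⟨k, hk'⟩ : ∃ k : ℕ, Fintype.card ι = k + 1 := ⟨Fintype.card ι - 1, by omega⟩
  set e : ι ≃ Fin (k + 1) := Fintype.equivFinOfCardEq hk' with he
  have hf' : IsBatemanHornSystem (f ∘ e.symm) := isBatemanHornSystem_comp hf e.symm.injective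
  obtain ⟨C, hC⟩ := fin_moebiusRootCount_div_logPowDecay k (f ∘ e.symm) hf' B
  refine ⟨C, fun N hN => ?_⟩
  have hρ : ∀ n : ℕ, polyRootCountMod f n = polyRootCountMod (f ∘ e.symm) n := fun n =>
    (polyRootCountMod_comp_equiv e.symm f n).symm
  simp_rw [hρ]
  exact hC N hN

end Summit.Parity.BatemanHorn.Theorems
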